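import Summits.ValiantsHypothesis.ValiantsHypothesis.Theorems.TwoProducts.RankThreeAffineToricWronskianCone
import Summits.ValiantsHypothesis.ValiantsHypothesis.Theorems.TwoProducts.RankThreeAffineOLMColumnsSkip

/-!
# Toric Wronskians of monomials, part 11: the ONE-VERTEX hypothesis shape `ConeTopBound` and its funnels to (TW-flag) / `OLMLaw` / `OLMUniformT` (LV-3b)

Sequel of ✓ `…ToricWronskianCone` (LV-3a: `coneTops`, `card_Eset_le_localised`).  Val-idea-crit-8 g6 VERDICT #124 / PRICE-W5: the open item of the
K1/K2 lines is to be NAMED as a one-resonant-vertex count.  THIS FILE: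
§1 ★ `card_resonant_vertices_le`: for pairwise distinct columns `e : Fin K → Expo` and EVERY carrier `u`, the support points that are a unique top in some
chart direction AND resonant for some pair (`det(e_i, v) = det(e_j, v)`, `i ≠ j`) number `≤ K(K−1)` — all such `v` lie on the resonance line
`det(e_i − e_j, ·) = 0` through the origin, on which every chart weight is a multiple of the position `⟨e_i − e_j, ·⟩` (`wt_eq_mul_pos_of_resonant`), so only
the two ξ-extremes can be unique tops (`pos_extreme_of_isUniqueTop`, `eq_of_resonant_of_pos_eq`; `two_mul_card_pairs_lt`: `2·#{i<j} = K(K−1)`).  t-FREE, u-FREE.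
§2 ★ `def ConeTopBound (R : ℕ → ℕ → ℕ) : Prop` — THE HYPOTHESIS SHAPE (NOT asserted; the only `Prop`-definition here, precedent ✓ `TWFlagBound` p713956):
for every flag `colFlag e l` (`l ≤ K`), every `t`-sparse `u` and every RESONANT vertex `v ∈ S1 u`, `|coneTops σ u v W| ≤ R K t`, `R` a FREE function.
★★ `twFlagBound_of_coneTopBound : ConeTopBound R → TWFlagBound (fun K t => t*t + t + K*(K−1)*R K t)` (localised count + `|Xc| ≤ t² + t` + non-resonant
vertices contribute 0 + never-top vertices contribute 0 + ≤ K(K−1) resonant unique-top vertices; degenerate carrier and repeated columns give `W`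
without edge directions).
§3 the funnels (Theorems-side bodies; the Cruxes names `OLMLaw` / `OLMUniformT` of the idea-35 workfile are these statements): ★★
`olm_nv_le_pow_of_coneTopBound` (`R K t ≤ (K+2)^a(t+2)^a` ⇒ `∃ c, nv(P(x,y,u)) ≤ (m+2)^c(t+2)^c`, via ✓ `olm_nv_le_pow_of_twFlag`, `coneTop_arith`); ★
`olm_nv_le_uniform_of_twFlag` (NEW uniform funnel: `TWFlagBound Q` with `Q K t ≤ C K·(t+2)^a`, `C` ARBITRARY in `K` ⇒ `∃ b, ∀ m, ∃ C′, nv ≤ C′·(t+2)^b`,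
`b = a + 2`, via ✓ `olm_nv_le_of_twFlag` and `K ≤ (m+1)²`); ★★ `olm_nv_le_uniform_of_coneTopBound` (`R K t ≤ g K·(t+2)^a`, `g` arbitrary ⇒ the body of
`OLMUniformT` with `b = a + 4`).  AFTER THIS FILE the question of record — «is the t-exponent of nv(P(x,y,u)) bounded independently of the degree?» — reads,
BY NAME and K-uniformly: `ConeTopBound R` with `R K t ≤ g(K)·(t+2)^a` (any `g`); its content files are the memo's LV-1 (level-extreme bookkeeping) and
LV-2 (mixed-word domination), OPEN.  HONEST LABEL: typed reduction / bookkeeping on the OPEN rung 3-AFF (side ladder, crux `stmt-ValiantsHypothesis-5906`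
`TwoProducts`); it moves the NAME of the open item, not its content; (TW-flag, poly) AT MERGES = `ConeTopBound`-poly, `OLMLaw`, `RankThreeAffineLaw(Exp)`,
`TwoProducts`, PCB, `ResidualLawV25` UNMOVED; 0 summit distance; VP ≠ VNP is NOT proved; no summit statement is proved here.
`--supports stmt-ValiantsHypothesis-5906 --as helper` (val-port-4 g6; critic of record val-idea-crit-8 g6).  One hypothesis-shape `def … : Prop` with
parameters (`ConeTopBound`); no instances, no notation, no named facts. [folklore]
-/

noncomputable section
set_option linter.dupNamespace false

namespace Summit.ValiantsHypothesis.ValiantsHypothesis.Theorems.TwoProducts.RankTwoJacobian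

open scoped BigOperators
open MvPolynomial
open Literature.LinearAlgebra.Matrix (wronskianMatrix wronskian wronskianMatrix_apply wronskian_def)

section TowerKernel
open scoped Classical

/-! ### §1 Resonance lines: at most `K(K−1)` resonant vertices, for every carrier -/

/-- on the resonance line of the pair `(i, j)` (`det(e_i − e_j, v) = 0`) the chart weight is proportional to the position `ξ(v) = ⟨e_i − e_j, v⟩`:
`|Δ|²·wt (dir σ μ) v = (μΔ₀ + σΔ₁)·ξ(v)`. [folklore] -/
theorem wt_eq_mul_pos_of_resonant {K : ℕ} (e : Fin K → Expo) (i j : Fin K) (σ μ : ℝ) {v : Expo} (hv : idet (e i) v = idet (e j) v) :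
    ((((e i 0 : ℕ) : ℝ) - (e j 0 : ℕ)) ^ 2 + (((e i 1 : ℕ) : ℝ) - (e j 1 : ℕ)) ^ 2) * wt (dir σ μ) v =
      (μ * (((e i 0 : ℕ) : ℝ) - (e j 0 : ℕ)) + σ * (((e i 1 : ℕ) : ℝ) - (e j 1 : ℕ))) *
        ((((e i 0 : ℕ) : ℝ) - (e j 0 : ℕ)) * (v 0 : ℕ) + (((e i 1 : ℕ) : ℝ) - (e j 1 : ℕ)) * (v 1 : ℕ)) := by
  have h : (((e i 0 : ℕ) : ℝ) - (e j 0 : ℕ)) * (v 1 : ℕ) = (((e i 1 : ℕ) : ℝ) - (e j 1 : ℕ)) * (v 0 : ℕ) := by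
    unfold idet at hv
    have hv' : ((e i 0 : ℕ) : ℤ) * (v 1 : ℕ) - ((e i 1 : ℕ) : ℤ) * (v 0 : ℕ) = ((e j 0 : ℕ) : ℤ) * (v 1 : ℕ) - ((e j 1 : ℕ) : ℤ) * (v 0 : ℕ) := hv
    have := congrArg (fun z : ℤ => (z : ℝ)) hv'
    push_cast at this
    linarith
  rw [wt_dir]
  linear_combination (σ * (((e i 0 : ℕ) : ℝ) - (e j 0 : ℕ)) - μ * (((e i 1 : ℕ) : ℝ) - (e j 1 : ℕ))) * h

/-- the position `ξ` is injective on the resonance line of a pair of DISTINCT columns. [folklore] -/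
theorem eq_of_resonant_of_pos_eq {K : ℕ} (e : Fin K → Expo) {i j : Fin K} (hij : e i ≠ e j) {v w : Expo}
    (hv : idet (e i) v = idet (e j) v) (hw : idet (e i) w = idet (e j) w)
    (hξ : (((e i 0 : ℕ) : ℤ) - (e j 0 : ℕ)) * (v 0 : ℕ) + (((e i 1 : ℕ) : ℤ) - (e j 1 : ℕ)) * (v 1 : ℕ) =
      (((e i 0 : ℕ) : ℤ) - (e j 0 : ℕ)) * (w 0 : ℕ) + (((e i 1 : ℕ) : ℤ) - (e j 1 : ℕ)) * (w 1 : ℕ)) : v = w := by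
  set D0 : ℤ := ((e i 0 : ℕ) : ℤ) - (e j 0 : ℕ) with hD0
  set D1 : ℤ := ((e i 1 : ℕ) : ℤ) - (e j 1 : ℕ) with hD1
  have hl : ∀ x : Expo, idet (e i) x = idet (e j) x → D0 * (x 1 : ℕ) = D1 * (x 0 : ℕ) := by
    intro x hx; unfold idet at hx; rw [hD0, hD1]; linarith
  have hv' := hl v hv
  have hw' := hl w hw
  set a : ℤ := ((v 0 : ℕ) : ℤ) - (w 0 : ℕ) with ha
  set b : ℤ := ((v 1 : ℕ) : ℤ) - (w 1 : ℕ) with hb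
  have h1 : D0 * a + D1 * b = 0 := by rw [ha, hb]; linear_combination hξ
  have h2 : D0 * b = D1 * a := by rw [ha, hb]; linear_combination hv' - hw'
  have hD : D0 ^ 2 + D1 ^ 2 ≠ 0 := by
    intro h0
    have h00 : D0 = 0 := by nlinarith
    have h11 : D1 = 0 := by nlinarith
    apply hij
    refine expo_eq_of_coords ?_ ?_
    · have : ((e i 0 : ℕ) : ℤ) = (e j 0 : ℕ) := by rw [hD0] at h00; linarith
      exact_mod_cast this
    · have : ((e i 1 : ℕ) : ℤ) = (e j 1 : ℕ) := by rw [hD1] at h11; linarith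
      exact_mod_cast this
  have ha0 : (D0 ^ 2 + D1 ^ 2) * a = 0 := by linear_combination D0 * h1 - D1 * h2
  have hb0 : (D0 ^ 2 + D1 ^ 2) * b = 0 := by linear_combination D1 * h1 + D0 * h2
  have ha' : a = 0 := (mul_eq_zero.mp ha0).resolve_left hD
  have hb' : b = 0 := (mul_eq_zero.mp hb0).resolve_left hD
  refine expo_eq_of_coords ?_ ?_
  · have : ((v 0 : ℕ) : ℤ) = (w 0 : ℕ) := by rw [ha] at ha'; linarith
    exact_mod_cast this
  · have : ((v 1 : ℕ) : ℤ) = (w 1 : ℕ) := by rw [hb] at hb'; linarith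
    exact_mod_cast this

/-- on the resonance line of a pair of distinct columns, a unique top of `u` (in some chart direction) is a STRICT EXTREME of the position `ξ` among the
support points of `u` on that line (the weight is a non-zero multiple of `ξ` there). [folklore] -/
theorem pos_extreme_of_isUniqueTop {K : ℕ} (e : Fin K → Expo) {i j : Fin K} (hij : e i ≠ e j) {σ μ : ℝ} {u : Poly2} {v : Expo}
    (hv : IsUniqueTop (dir σ μ) u v) (hres : idet (e i) v = idet (e j) v) :
    (∀ w ∈ u.support, w ≠ v → idet (e i) w = idet (e j) w →
      (((e i 0 : ℕ) : ℤ) - (e j 0 : ℕ)) * (w 0 : ℕ) + (((e i 1 : ℕ) : ℤ) - (e j 1 : ℕ)) * (w 1 : ℕ) <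
        (((e i 0 : ℕ) : ℤ) - (e j 0 : ℕ)) * (v 0 : ℕ) + (((e i 1 : ℕ) : ℤ) - (e j 1 : ℕ)) * (v 1 : ℕ)) ∨
    (∀ w ∈ u.support, w ≠ v → idet (e i) w = idet (e j) w →
      (((e i 0 : ℕ) : ℤ) - (e j 0 : ℕ)) * (v 0 : ℕ) + (((e i 1 : ℕ) : ℤ) - (e j 1 : ℕ)) * (v 1 : ℕ) <
        (((e i 0 : ℕ) : ℤ) - (e j 0 : ℕ)) * (w 0 : ℕ) + (((e i 1 : ℕ) : ℤ) - (e j 1 : ℕ)) * (w 1 : ℕ)) := by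
  set c : ℝ := μ * (((e i 0 : ℕ) : ℝ) - (e j 0 : ℕ)) + σ * (((e i 1 : ℕ) : ℝ) - (e j 1 : ℕ)) with hc
  set N2 : ℝ := (((e i 0 : ℕ) : ℝ) - (e j 0 : ℕ)) ^ 2 + (((e i 1 : ℕ) : ℝ) - (e j 1 : ℕ)) ^ 2 with hN2
  have hN2pos : 0 ≤ N2 := by rw [hN2]; positivity
  have key : ∀ w ∈ u.support, w ≠ v → idet (e i) w = idet (e j) w →
      c * ((((e i 0 : ℕ) : ℝ) - (e j 0 : ℕ)) * (w 0 : ℕ) + (((e i 1 : ℕ) : ℝ) - (e j 1 : ℕ)) * (w 1 : ℕ)) <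
      c * ((((e i 0 : ℕ) : ℝ) - (e j 0 : ℕ)) * (v 0 : ℕ) + (((e i 1 : ℕ) : ℝ) - (e j 1 : ℕ)) * (v 1 : ℕ)) := by
    intro w hw hwv hresw
    have hlt := hv.2 w hw hwv
    have h1 := wt_eq_mul_pos_of_resonant e i j σ μ hres
    have h2 := wt_eq_mul_pos_of_resonant e i j σ μ hresw
    rw [← hN2, ← hc] at h1 h2
    have hN2ne : N2 ≠ 0 := by
      intro h0
      have h00 : (((e i 0 : ℕ) : ℝ) - (e j 0 : ℕ)) = 0 := by rw [hN2] at h0; nlinarith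
      have h11 : (((e i 1 : ℕ) : ℝ) - (e j 1 : ℕ)) = 0 := by rw [hN2] at h0; nlinarith
      exact hij (expo_eq_of_coords (by exact_mod_cast (sub_eq_zero.mp h00)) (by exact_mod_cast (sub_eq_zero.mp h11)))
    have hN2pos' : 0 < N2 := lt_of_le_of_ne hN2pos (Ne.symm hN2ne)
    nlinarith
  rcases lt_trichotomy c 0 with hc0 | hc0 | hc0
  · right
    intro w hw hwv hresw
    have h := key w hw hwv hresw
    have h' : ((((e i 0 : ℕ) : ℝ) - (e j 0 : ℕ)) * (v 0 : ℕ) + (((e i 1 : ℕ) : ℝ) - (e j 1 : ℕ)) * (v 1 : ℕ)) <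
        ((((e i 0 : ℕ) : ℝ) - (e j 0 : ℕ)) * (w 0 : ℕ) + (((e i 1 : ℕ) : ℝ) - (e j 1 : ℕ)) * (w 1 : ℕ)) := by nlinarith
    have h'' : (((((e i 0 : ℕ) : ℤ) - (e j 0 : ℕ)) * (v 0 : ℕ) + (((e i 1 : ℕ) : ℤ) - (e j 1 : ℕ)) * (v 1 : ℕ) : ℤ) : ℝ) <
        (((((e i 0 : ℕ) : ℤ) - (e j 0 : ℕ)) * (w 0 : ℕ) + (((e i 1 : ℕ) : ℤ) - (e j 1 : ℕ)) * (w 1 : ℕ) : ℤ) : ℝ) := by push_cast; exact h'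
    exact_mod_cast h''
  · -- `c = 0`: every other line point would give `0 < 0`, so the first disjunct holds vacuously
    left
    intro w hw hwv hresw
    have h := key w hw hwv hresw
    rw [hc0, zero_mul, zero_mul] at h
    exact absurd h (lt_irrefl _)
  · left
    intro w hw hwv hresw
    have h := key w hw hwv hresw
    have h' : ((((e i 0 : ℕ) : ℝ) - (e j 0 : ℕ)) * (w 0 : ℕ) + (((e i 1 : ℕ) : ℝ) - (e j 1 : ℕ)) * (w 1 : ℕ)) <
        ((((e i 0 : ℕ) : ℝ) - (e j 0 : ℕ)) * (v 0 : ℕ) + (((e i 1 : ℕ) : ℝ) - (e j 1 : ℕ)) * (v 1 : ℕ)) := by nlinarith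
    have h'' : (((((e i 0 : ℕ) : ℤ) - (e j 0 : ℕ)) * (w 0 : ℕ) + (((e i 1 : ℕ) : ℤ) - (e j 1 : ℕ)) * (w 1 : ℕ) : ℤ) : ℝ) <
        (((((e i 0 : ℕ) : ℤ) - (e j 0 : ℕ)) * (v 0 : ℕ) + (((e i 1 : ℕ) : ℤ) - (e j 1 : ℕ)) * (v 1 : ℕ) : ℤ) : ℝ) := by push_cast; exact h'
    exact_mod_cast h''

/-- the number of pairs `i < j` in `Fin K` is `K(K−1)/2` (doubled form). [folklore] -/
theorem two_mul_card_pairs_lt (K : ℕ) : 2 * ((Finset.univ : Finset (Fin K × Fin K)).filter fun ij => ij.1 < ij.2).card = K * (K - 1) := by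
  have h : ((Finset.univ : Finset (Fin K × Fin K)).filter fun ij => ij.1 < ij.2).card = ∑ j : Fin K, (j : ℕ) := by
    rw [Finset.card_filter, Fintype.sum_prod_type_right]
    refine Finset.sum_congr rfl fun j _ => ?_
    simp only
    rw [← Finset.card_filter, Finset.filter_gt_eq_Iio, Fin.card_Iio]
  rw [h, Fin.sum_univ_eq_sum_range (fun i => i) K, mul_comm, Finset.sum_range_id_mul_two]

/-- ★ **AT MOST `K(K−1)` RESONANT VERTICES, for every carrier `u` and every `t` (val-idea-crit-8 g6, PRICE-W5 (c)):** with pairwise distinct columns,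
the support points of `u` that are a unique top in some chart direction AND resonant for some pair of columns number at most `K(K−1)` — two per unordered
pair, the extremes of the resonance line `det(e_i − e_j, ·) = 0` through the origin, along which every chart weight is monotone. [folklore] -/
theorem card_resonant_vertices_le (σ : ℝ) (u : Poly2) {K : ℕ} (e : Fin K → Expo) (he : Function.Injective e) :
    (u.support.filter fun v => (∃ μ : ℝ, IsUniqueTop (dir σ μ) u v) ∧ ∃ i j : Fin K, i ≠ j ∧ idet (e i) v = idet (e j) v).card ≤ K * (K - 1) := by
  set P : Finset (Fin K × Fin K) := Finset.univ.filter fun ij => ij.1 < ij.2 with hP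
  set A : Fin K × Fin K → Finset Expo := fun ij => u.support.filter fun v =>
      (∃ μ : ℝ, IsUniqueTop (dir σ μ) u v) ∧ idet (e ij.1) v = idet (e ij.2) v with hA
  have hsub : (u.support.filter fun v => (∃ μ : ℝ, IsUniqueTop (dir σ μ) u v) ∧ ∃ i j : Fin K, i ≠ j ∧ idet (e i) v = idet (e j) v) ⊆
      P.biUnion A := by
    intro v hv
    obtain ⟨hvs, hμ, i, j, hij, hres⟩ := Finset.mem_filter.mp hv
    rcases lt_or_gt_of_ne hij with h | h
    · exact Finset.mem_biUnion.mpr ⟨(i, j), Finset.mem_filter.mpr ⟨Finset.mem_univ _, h⟩, Finset.mem_filter.mpr ⟨hvs, hμ, hres⟩⟩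
    · exact Finset.mem_biUnion.mpr ⟨(j, i), Finset.mem_filter.mpr ⟨Finset.mem_univ _, h⟩, Finset.mem_filter.mpr ⟨hvs, hμ, hres.symm⟩⟩
  have hA2 : ∀ ij ∈ P, (A ij).card ≤ 2 := by
    intro ij hij
    have hlt : ij.1 < ij.2 := (Finset.mem_filter.mp hij).2
    have hne : e ij.1 ≠ e ij.2 := fun h => absurd (he h) (ne_of_lt hlt)
    by_contra h3
    obtain ⟨x, y, z, hx, hy, hz, hxy, hxz, hyz⟩ := Finset.two_lt_card_iff.mp (not_le.mp h3)
    obtain ⟨hxs, ⟨μx, hμx⟩, hrx⟩ := Finset.mem_filter.mp hx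
    obtain ⟨hys, ⟨μy, hμy⟩, hry⟩ := Finset.mem_filter.mp hy
    obtain ⟨hzs, ⟨μz, hμz⟩, hrz⟩ := Finset.mem_filter.mp hz
    have ex := pos_extreme_of_isUniqueTop e hne hμx hrx
    have ey := pos_extreme_of_isUniqueTop e hne hμy hry
    have ez := pos_extreme_of_isUniqueTop e hne hμz hrz
    rcases ex with hx' | hx' <;> rcases ey with hy' | hy' <;> rcases ez with hz' | hz' <;>
      first
        | exact absurd (hx' y hys (Ne.symm hxy) hry) (not_lt.mpr (le_of_lt (hy' x hxs hxy hrx)))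
        | exact absurd (hx' z hzs (Ne.symm hxz) hrz) (not_lt.mpr (le_of_lt (hz' x hxs hxz hrx)))
        | exact absurd (hy' z hzs (Ne.symm hyz) hrz) (not_lt.mpr (le_of_lt (hz' y hys hyz hry)))
  calc (u.support.filter fun v => (∃ μ : ℝ, IsUniqueTop (dir σ μ) u v) ∧ ∃ i j : Fin K, i ≠ j ∧ idet (e i) v = idet (e j) v).card
      ≤ (P.biUnion A).card := Finset.card_le_card hsub
    _ ≤ ∑ ij ∈ P, (A ij).card := Finset.card_biUnion_le
    _ ≤ ∑ _ij ∈ P, 2 := Finset.sum_le_sum hA2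
    _ = K * (K - 1) := by rw [Finset.sum_const, smul_eq_mul, mul_comm, hP, two_mul_card_pairs_lt]

/-! ### §2 The one-vertex hypothesis shape and the (TW-flag) funnel -/

/-- the support of the normalised carrier `u − u(0)` is exactly `S1 u`. [folklore] -/
theorem support_sub_C_coeff_zero (u : Poly2) : (u - C (coeff 0 u)).support = S1 u := by
  ext s
  rw [mem_S1, MvPolynomial.mem_support_iff, MvPolynomial.mem_support_iff, coeff_sub, coeff_C]
  by_cases h0 : s = 0
  · subst h0; simp
  · rw [if_neg (Ne.symm h0), sub_zero]; exact ⟨fun h => ⟨h, h0⟩, fun h => h.1⟩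

/-- (TW-cone) as a HYPOTHESIS SHAPE (NOT asserted; the only `Prop`-definition of this file, precedent ✓ `TWFlagBound`): a bound `R K t` (`R` a FREE
function) on the number of CONE TOPS of every flag toric Wronskian at every RESONANT vertex `v ∈ S1 u` (two columns of the flag with
`det(e_i, v) = det(e_j, v)`).  THE QUESTION of the side ladder, localised to one resonant vertex (val-idea-crit-8 g6, memo rev C (C1), #124). -/
def ConeTopBound (R : ℕ → ℕ → ℕ) : Prop :=
  ∀ (σ : ℝ), (σ = 1 ∨ σ = -1) → ∀ (K t : ℕ) (u : Poly2), u.support.card ≤ t → ∀ (e : Fin K → Expo) (l : ℕ), l ≤ K → ∀ v ∈ S1 u,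
    (∃ i j : Fin l, i ≠ j ∧ idet (eExt e i) v = idet (eExt e j) v) →
    (coneTops σ u v (wronskian (⇑(jacDer u)) (colFlag e l))).card ≤ R K t

/-- ★★ **`ConeTopBound R ⟹ TWFlagBound (t² + t + K(K−1)·R)`:** the localised count (✓ `card_Eset_le_localised`), `|Xc σ u| ≤ t² + t`, non-resonant
vertices contribute `0` (✓ `card_coneTops_toricW_sub_one_eq_zero`), vertices that are never a unique top contribute `0`, and at most `K(K−1)` resonant
unique-top vertices remain (✓ `card_resonant_vertices_le`), each contributing `≤ R K t`. -/
theorem twFlagBound_of_coneTopBound {R : ℕ → ℕ → ℕ} (hR : ConeTopBound R) : TWFlagBound (fun K t => t * t + t + K * (K - 1) * R K t) := by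
  intro σ hσ K t u hu e l hl
  set f : Fin l → Expo := fun k => eExt e k with hf
  have hW : wronskian (⇑(jacDer u)) (colFlag e l) = wronskian (⇑(jacDer u)) (fun k => monomial (f k) (1 : ℂ)) := rfl
  -- degenerate carrier: `u − u(0) = 0`
  by_cases hu0 : u - C (coeff 0 u) = 0
  · rw [hW, ← jacDer_sub_C u (coeff 0 u), hu0]
    have h := toricW_Eset_subset_of_generic hσ (0 : Poly2) f
      (fun s hs => by rw [support_zero] at hs; exact absurd hs (Finset.notMem_empty _))
    rw [Eset_zero, Finset.subset_empty] at h
    rw [h, Finset.card_empty]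
    exact Nat.zero_le _
  -- repeated columns kill the Wronskian
  by_cases hinj : Function.Injective f
  swap
  · have hz : wronskian (⇑(jacDer u)) (fun k => monomial (f k) (1 : ℂ)) = 0 := by
      simp only [Function.Injective, not_forall] at hinj
      obtain ⟨i, j, hfe, hij⟩ := hinj
      rw [wronskian_def]
      exact Matrix.det_zero_of_column_eq hij fun k => by rw [wronskianMatrix_apply, wronskianMatrix_apply, hfe]
    rw [hW, hz, Eset_zero, Finset.card_empty]
    exact Nat.zero_le _
  rw [hW]
  refine (card_Eset_le_localised hσ hu0 _).trans (Nat.add_le_add ((card_Xc_le σ u).trans (Nat.add_le_add (Nat.mul_le_mul hu hu) hu)) ?_)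
  set good : Expo → Prop := fun v => (∃ μ : ℝ, IsUniqueTop (dir σ μ) (u - C (coeff 0 u)) v) ∧ ∃ i j : Fin l, i ≠ j ∧ idet (f i) v = idet (f j) v
    with hgood
  rw [← Finset.sum_filter_add_sum_filter_not (S1 u) good]
  have hzero : ∑ v ∈ (S1 u).filter (fun v => ¬ good v),
      ((coneTops σ u v (wronskian (⇑(jacDer u)) (fun k => monomial (f k) (1 : ℂ)))).card - 1) = 0 := by
    refine Finset.sum_eq_zero fun v hv => ?_
    have hng : ¬ good v := (Finset.mem_filter.mp hv).2
    rw [hgood] at hng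
    simp only [not_and_or, not_exists] at hng
    rcases hng with h | h
    · have hempty : coneTops σ u v (wronskian (⇑(jacDer u)) (fun k => monomial (f k) (1 : ℂ))) = ∅ :=
        Finset.eq_empty_of_forall_notMem fun P hP => by
          obtain ⟨-, μ, -, hv, -⟩ := Finset.mem_filter.mp hP
          exact h μ hv
      rw [hempty, Finset.card_empty]
      omega
    · refine card_coneTops_toricW_sub_one_eq_zero σ u f fun i j hij => ?_
      by_contra hne
      rcases h i j with h' | h'
      · exact h' hne
      · exact h' hij
  rw [hzero, add_zero]
  have hR' : ∀ v ∈ (S1 u).filter good,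
      (coneTops σ u v (wronskian (⇑(jacDer u)) (fun k => monomial (f k) (1 : ℂ)))).card - 1 ≤ R K t := by
    intro v hv
    obtain ⟨hvS, -, i, j, hij, hres⟩ := Finset.mem_filter.mp hv
    have h := hR σ hσ K t u hu e l hl v hvS ⟨i, j, hij, hres⟩
    rw [hW] at h
    omega
  refine (Finset.sum_le_card_nsmul _ _ _ hR').trans ?_
  rw [smul_eq_mul]
  refine Nat.mul_le_mul_right _ ?_
  have hcount := card_resonant_vertices_le σ (u - C (coeff 0 u)) f hinj
  rw [support_sub_C_coeff_zero] at hcount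
  exact hcount.trans (Nat.mul_le_mul hl (Nat.sub_le_sub_right hl 1))

/-! ### §3 The funnels: polynomial `R` ⇒ the body of `OLMLaw`; `R` polynomial in `t` only ⇒ the body of `OLMUniformT` -/

/-- the closing arithmetic: `t² + t + K(K−1)·(K+2)^a(t+2)^a ≤ (K+2)^{a+3}(t+2)^{a+3}`. [folklore] -/
theorem coneTop_arith (K t a : ℕ) : t * t + t + K * (K - 1) * ((K + 2) ^ a * (t + 2) ^ a) ≤ (K + 2) ^ (a + 3) * (t + 2) ^ (a + 3) := by
  set Y : ℕ := (K + 2) ^ (a + 2) * (t + 2) ^ (a + 2) with hY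
  have hK1 : 1 ≤ (K + 2) ^ (a + 2) := Nat.one_le_pow _ _ (by omega)
  have ht1 : (t + 2) ^ 2 ≤ (t + 2) ^ (a + 2) := Nat.pow_le_pow_right (by omega) (by omega)
  have h1 : t * t + t ≤ Y := by
    calc t * t + t ≤ (t + 2) ^ 2 := by nlinarith
      _ ≤ (t + 2) ^ (a + 2) := ht1
      _ ≤ (K + 2) ^ (a + 2) * (t + 2) ^ (a + 2) := Nat.le_mul_of_pos_left _ hK1
  have h2 : K * (K - 1) * ((K + 2) ^ a * (t + 2) ^ a) ≤ Y := by
    have hKK : K * (K - 1) ≤ (K + 2) ^ 2 := by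
      have : K - 1 ≤ K + 2 := by omega
      calc K * (K - 1) ≤ (K + 2) * (K + 2) := Nat.mul_le_mul (by omega) this
        _ = (K + 2) ^ 2 := (sq _).symm
    have hta : (t + 2) ^ a ≤ (t + 2) ^ (a + 2) := Nat.pow_le_pow_right (by omega) (by omega)
    calc K * (K - 1) * ((K + 2) ^ a * (t + 2) ^ a) ≤ (K + 2) ^ 2 * ((K + 2) ^ a * (t + 2) ^ (a + 2)) :=
          Nat.mul_le_mul hKK (Nat.mul_le_mul_left _ hta)
      _ = Y := by rw [hY]; ring
  have h3 : 2 * Y ≤ (K + 2) ^ (a + 3) * (t + 2) ^ (a + 3) := by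
    have : (K + 2) ^ (a + 3) * (t + 2) ^ (a + 3) = ((K + 2) * (t + 2)) * Y := by rw [hY]; ring
    rw [this]
    exact Nat.mul_le_mul_right _ (by nlinarith)
  omega

/-- ★★ **THE BODY OF `OLMLaw` FROM A POLYNOMIAL ONE-VERTEX BOUND:** `ConeTopBound R` with `R K t ≤ (K+2)^a (t+2)^a` gives
`∃ c, ∀ m t P u, deg P ≤ m → |supp u| ≤ t → nv (P(x, y, u)) ≤ (m+2)^c (t+2)^c` (✓ `olm_nv_le_pow_of_twFlag` on `twFlagBound_of_coneTopBound`; the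
Cruxes-side `OLMLaw` is this statement by name, `olmLaw_of_twFlagPoly`). -/
theorem olm_nv_le_pow_of_coneTopBound {R : ℕ → ℕ → ℕ} (hR : ConeTopBound R) {a : ℕ} (hRa : ∀ K t, R K t ≤ (K + 2) ^ a * (t + 2) ^ a) :
    ∃ c : ℕ, ∀ (m t : ℕ) (P : Poly3) (u : Poly2),
      P.totalDegree ≤ m → u.support.card ≤ t →
      nv (MvPolynomial.aeval ![X 0, X 1, u] P) ≤ (m + 2) ^ c * (t + 2) ^ c :=
  olm_nv_le_pow_of_twFlag (twFlagBound_of_coneTopBound hR) (a := a + 3) fun K t =>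
    (Nat.add_le_add_left (Nat.mul_le_mul_left _ (hRa K t)) _).trans (coneTop_arith K t a)

/-- ★ **THE UNIFORM FUNNEL** («t-exponent independent of the degree», the shape of the Cruxes-side `OLMUniformT`): a `TWFlagBound Q` with
`Q K t ≤ C K · (t+2)^a` for an ARBITRARY function `C` of `K` gives `∃ b, ∀ m, ∃ C′, ∀ t P u, deg P ≤ m → |supp u| ≤ t → nv (P(x,y,u)) ≤ C′·(t+2)^b`
(`b = a + 2`; `C′` depends on `m` through `K ≤ (m+1)²` and `max_{K ≤ (m+1)²} C K`). -/
theorem olm_nv_le_uniform_of_twFlag {Q : ℕ → ℕ → ℕ} (hQ : TWFlagBound Q) {C : ℕ → ℕ} {a : ℕ} (hQa : ∀ K t, Q K t ≤ C K * (t + 2) ^ a) :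
    ∃ b : ℕ, ∀ m : ℕ, ∃ C' : ℕ, ∀ (t : ℕ) (P : Poly3) (u : Poly2),
      P.totalDegree ≤ m → u.support.card ≤ t →
      nv (MvPolynomial.aeval ![X 0, X 1, u] P) ≤ C' * (t + 2) ^ b := by
  refine ⟨a + 2, fun m => ?_⟩
  set Km : ℕ := (m + 1) ^ 2 with hKm
  set Cm : ℕ := ∑ K ∈ Finset.range (Km + 1), C K with hCm
  refine ⟨2 * (3 * Km + 3 * Km + 3 * (Km * (Km * Cm))) + 4, fun t P u hP hu => ?_⟩
  set K := (P.support.image ufree).card with hK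
  have h0 := olm_nv_le_of_twFlag hQ t u hu P (P.support.image ufree) fun s hs => Finset.mem_image_of_mem _ hs
  rw [← hK] at h0
  have hKm' : K ≤ Km := card_ufree_image_le P hP
  have hCK : C K ≤ Cm := by
    rw [hCm]
    exact Finset.single_le_sum (f := C) (fun _ _ => Nat.zero_le _) (Finset.mem_range.mpr (by omega))
  have hT1 : 1 ≤ (t + 2) ^ (a + 2) := Nat.one_le_pow _ _ (by omega)
  have hT2 : t * t + t ≤ (t + 2) ^ (a + 2) := by
    calc t * t + t ≤ (t + 2) ^ 2 := by nlinarith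
      _ ≤ (t + 2) ^ (a + 2) := Nat.pow_le_pow_right (by omega) (by omega)
  have hTa : (t + 2) ^ a ≤ (t + 2) ^ (a + 2) := Nat.pow_le_pow_right (by omega) (by omega)
  have hQ' : Q K t ≤ Cm * (t + 2) ^ (a + 2) :=
    (hQa K t).trans (Nat.mul_le_mul hCK hTa)
  have e1 : 3 * K * (t * t + t) ≤ 3 * Km * (t + 2) ^ (a + 2) := Nat.mul_le_mul (Nat.mul_le_mul_left _ hKm') hT2
  have e2 : 3 * K ≤ 3 * Km * (t + 2) ^ (a + 2) := by
    calc 3 * K ≤ 3 * Km := Nat.mul_le_mul_left _ hKm'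
      _ ≤ 3 * Km * (t + 2) ^ (a + 2) := Nat.le_mul_of_pos_right _ hT1
  have e3 : 3 * (K * (K * Q K t)) ≤ 3 * (Km * (Km * Cm)) * (t + 2) ^ (a + 2) := by
    calc 3 * (K * (K * Q K t)) ≤ 3 * (Km * (Km * (Cm * (t + 2) ^ (a + 2)))) :=
          Nat.mul_le_mul_left _ (Nat.mul_le_mul hKm' (Nat.mul_le_mul hKm' hQ'))
      _ = 3 * (Km * (Km * Cm)) * (t + 2) ^ (a + 2) := by ring
  have e4 : 4 ≤ 4 * (t + 2) ^ (a + 2) := Nat.le_mul_of_pos_right _ hT1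
  calc nv (MvPolynomial.aeval ![X 0, X 1, u] P) ≤ 2 * (3 * K * (t * t + t) + 3 * K + 3 * (K * (K * Q K t))) + 4 := h0
    _ ≤ 2 * (3 * Km * (t + 2) ^ (a + 2) + 3 * Km * (t + 2) ^ (a + 2) + 3 * (Km * (Km * Cm)) * (t + 2) ^ (a + 2)) + 4 * (t + 2) ^ (a + 2) := by
        have := Nat.add_le_add (Nat.add_le_add e1 e2) e3; omega
    _ = (2 * (3 * Km + 3 * Km + 3 * (Km * (Km * Cm))) + 4) * (t + 2) ^ (a + 2) := by ring

/-- ★★ **THE UNIFORM FUNNEL FROM THE CONE: `ConeTopBound R` with `R K t ≤ g K · (t+2)^a` (`g` ARBITRARY in `K`) gives the body of `OLMUniformT`** with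
`t`-exponent `a + 4` — THE QUESTION of the side ladder («is the t-exponent of nv(P(x,y,u)) bounded independently of the degree?») is thereby reduced,
BY NAME and K-uniformly, to a one-resonant-vertex count with any K-dependence whatsoever. -/
theorem olm_nv_le_uniform_of_coneTopBound {R : ℕ → ℕ → ℕ} (hR : ConeTopBound R) {g : ℕ → ℕ} {a : ℕ} (hRa : ∀ K t, R K t ≤ g K * (t + 2) ^ a) :
    ∃ b : ℕ, ∀ m : ℕ, ∃ C' : ℕ, ∀ (t : ℕ) (P : Poly3) (u : Poly2),
      P.totalDegree ≤ m → u.support.card ≤ t →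
      nv (MvPolynomial.aeval ![X 0, X 1, u] P) ≤ C' * (t + 2) ^ b := by
  refine olm_nv_le_uniform_of_twFlag (twFlagBound_of_coneTopBound hR) (C := fun K => 1 + K * K * g K) (a := a + 2) fun K t => ?_
  have hT1 : 1 ≤ (t + 2) ^ (a + 2) := Nat.one_le_pow _ _ (by omega)
  have hT2 : t * t + t ≤ (t + 2) ^ (a + 2) := by
    calc t * t + t ≤ (t + 2) ^ 2 := by nlinarith
      _ ≤ (t + 2) ^ (a + 2) := Nat.pow_le_pow_right (by omega) (by omega)
  have hTa : (t + 2) ^ a ≤ (t + 2) ^ (a + 2) := Nat.pow_le_pow_right (by omega) (by omega)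
  have h2 : K * (K - 1) * R K t ≤ K * K * g K * (t + 2) ^ (a + 2) := by
    calc K * (K - 1) * R K t ≤ K * K * (g K * (t + 2) ^ (a + 2)) :=
          Nat.mul_le_mul (Nat.mul_le_mul_left _ (Nat.sub_le _ _)) ((hRa K t).trans (Nat.mul_le_mul_left _ hTa))
      _ = K * K * g K * (t + 2) ^ (a + 2) := by ring
  calc t * t + t + K * (K - 1) * R K t ≤ (t + 2) ^ (a + 2) + K * K * g K * (t + 2) ^ (a + 2) := Nat.add_le_add hT2 h2
    _ = (1 + K * K * g K) * (t + 2) ^ (a + 2) := by ring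

end TowerKernel

end Summit.ValiantsHypothesis.ValiantsHypothesis.Theorems.TwoProducts.RankTwoJacobian

end
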